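/-
Copyright: lit-balaban reader/typer seat r18 (gen 8), C2 §§1–4 fold owner.  Statement-level skeleton of a published paper; no proof
claims beyond what the kernel checks below.
-/
import Literature.MathematicalPhysics.QuantumFieldTheory.BalabanImbrieJaffe1984to88.BIJ88Decay216Torus
import Literature.MathematicalPhysics.QuantumFieldTheory.BalabanImbrieJaffe1984to88.BIJ85SigmaTorusScaling
import Literature.MathematicalPhysics.QuantumFieldTheory.BalabanImbrieJaffe1984to88.BIJ88Ineq219TorusProp12

/-!
# `BalabanImbrieJaffe1984to88.BIJ88Decay216Native` — T. Bałaban, J. Imbrie, A. Jaffe, *Effective action and cluster properties of the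
abelian Higgs model*, Commun. Math. Phys. **114** (1988) 257–315 [BalabanImbrieJaffe1988]: **(2.16)** p. 261 (and its corollary (2.17)
p. 262) ON THE TORI OF THE SERIES FOR p30's `sigmaTorus`, from the gradient member of [I] (7.2.2) and **(7.2.3) AS PRINTED — for the
UNIT-LATTICE propagators `C^{(j)}`** ([I] = [BalabanImbrieJaffe1985] (4.3.3)–(4.3.5), (7.2.3) *"for x, y ∈ T₁^{(k)}"*), at every
dimension `d ≥ 2`; together with the kernel-checked RESCALING DICTIONARY behind C2 (2.12) *"Superscripts L^jη, η, etc. indicate the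
lattice spacing for operators rescaled to nonstandard lattices"* and [I] (4.4.4) *"the propagators C^{(j)} are defined by the formula
(4.3.3) but on the L^jη = L^{j−k} lattice, rather than on the unit lattice"*: in the tree's normalisation
`CE P w c j = (w·c²)⁻¹ • CE P 1 1 j`, hence `CE P η_k^d L^k j = L^{(k−j)(d−2)} • CE P η_j^d L^j j`

statement-level skeleton of published theorems with citation tags; proofs where landed; nothing here is a claim about the Yang–Mills mass gap

PDF held: `paper:balaban1988-cmp114-bij-abelian-higgs-effective-action` (journal page = PDF page + 256), p. 261 [PDF 5], p. 262 [PDF 6];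
[I] = `paper:balaban1985-cmp97-bij-higgs-minimizers` (journal page = PDF page + 298), pp. 311–312 [PDF 13–14], p. 325 [PDF 27] (text
layers read this session).

CITATION HEADER (lean-in-tree rule).  Part of the lit-balaban TYPED SKELETON (HOME `run/shared/lean/pub/lit-balaban/`), reader/typer seat
r18 (gen 8), unit `lit-balaban-r18`; WHAT IS REPRODUCED = SKELETON row **C2.Eq2.16** (owner r18, referee ref-5) — the owner's native-(7.2.3)
assembly announced in HOME/STATUS.md (gen 8, OWNER NOTE O-C2-16 on p08's `BIJ88Decay216Torus`) — and the (2.17) corollary (row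
**C2.Eq2.17**); joined to rows **C1.Eq7.2.1-7.2.2**, **C1.Eq7.2.3**, **C1.Eq4.4.4** (owner r15) and **C2.Eq2.12**.  Decls of record used BY
NAME (nothing restated): p08's `BIJ88Decay216Torus.abs_term_le` (the scale-`j` term, PUBLIC and per scale), `sum_plaq_exp_neg_pdist_le`,
`cBound_of_ineq723`, `BIJ88SigmaKernelDkTorus.sigmaKernel_offDiag_eq_sum`, `BIJ88Ineq217Ineq722Torus.exists_bound_of_ineq722` /
`abs_ineq217_ineq722_torus`; p09's `axialPropagator`/`formInv`/`formOp`/`curlOp`; p30's `HaxOp`, `sigmaTorus`; p11's `HaxE`/`CE`;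
r15's typed `KernelData.Ineq722`/`Ineq723`; p09's `torusKernelData`, `ineq722_deltaA_of_prop12Printed`.

THE PRINTED TEXT (p. 261 [PDF 5], verbatim): *"Writing 𝒟_k in hierarchical form as in (2.12) and using the regularity of H_j, 𝒟_j,
j < k, we see that |σ_k(p₁,p₂)| ≦ ce^{−c dist(p₁,p₂)} for dist(p₁,p₂) ≧ c. (2.16) [The rapid decay of the terms with small j
compensates for the scaling factors (L^jη)^{−1}.]"*; [I] p. 311: *"The actions Δ_k and propagators C^{(k)} were studied by Bałaban [6II]
who established that C^{(k)} is well defined and is bounded in norm ‖C^{(k)}‖ ≦ c (4.3.4) uniformly in k. Furthermore C^{(k)} has a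
kernel which decays exponentially, uniformly in k. (4.3.5)"*; p. 312: *"Similarly the propagators C^{(j)} are defined by the formula
(4.3.3) but on the L^jη = L^{j−k} lattice, rather than on the unit lattice."*; p. 325: *"The unit lattice propagator C^{(k)} also has
exponential decay, |C^{(k)}_{μν}(x,y)| ≦ Me^{−δ|x−y|}, (7.2.3) for x, y ∈ T₁^{(k)}."*

WHY THIS FILE (owner note O-C2-16, SECONDREAD-C2 § Gen 8).  p08's `BIJ88Decay216Torus` proves (2.16) on the tori under a (7.2.3)-shape
hypothesis on the matrices of `CE P η_k^d L^k j` — [I]'s C^{(j)} RESCALED to the `L^jη` lattice — with ONE pair of constants for all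
`j < k`.  §1 below proves `CE P η_k^d L^k j = L^{(k−j)(d−2)} • CE P η_j^d L^j j`: that hypothesis IS (7.2.3) at `d = 2` and is stronger
than (7.2.3) by the factor `L^{(k−j)(d−2)}` at `d ≥ 3`.  §§2–3 re-run p08's multiscale sum with the scale-`j` constant
`M_C·L^{(k−j)(d−2)}` — one more *"scaling factor"* of the print's bracket, absorbed by the same decay: `L^{dn}e^{−aLⁿ} ≤ (d+1)!/(a^{d+1}Lⁿ)`.

WHAT IS PROVED (0 `sorry`, standard axioms; theorems only — proof lane; `k ≤ m + K`, `2 ≤ d` where stated):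
* §1 THE RESCALING DICTIONARY (`ringInverse_smul`, `adjoint_smul'` private plumbing): `formOp_smul`, `formInv_smul`, **`axialPropagator_smul`**
  (`axialPropagator V (s•D) = (s²)⁻¹ • axialPropagator V D`, `s ≠ 0`), **`haxOp_smul`** (`HaxOp V (s•D) Qs = HaxOp V D Qs`),
  p30's `BIJ85SigmaTorusScaling.curlOp_eq_smul` (`curlOp w c = (√w·c) • curlOp 1 1`, by name), **`haxE_eq_haxE_one`**, **`cE_eq_smul_cE_one`** (`CE P w c j = (w·c²)⁻¹ •
  CE P 1 1 j`), `cE_eta_eq` (`CE P η_k^d L^k j = (L^k)^{d−2} • CE P 1 1 j`), **`cE_ambient_eq_native`** (`j ≤ k`: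
  `CE P η_k^d L^k j = (L^{k−j})^{d−2} • CE P η_j^d L^j j`), `cE_ambient_eq_native_two` (`d = 2`: equal), `inner_cE_ambient_eq`,
  `abs_inner_cE_ambient_le` (a native bound `M_C e^{−δ_C|b−b′|}` gives the ambient bound with `M_C·(L^{k−j})^{d−2}`).
* §2 **(2.16) ON THE TORI FROM THE NATIVE (7.2.3)** (private plumbing `pow_mul_exp_neg_le`: `x^q e^{−ax} ≤ (q+1)!/(a^{q+1}x)`, `sum_inv_pow_le_one'`):
  **`abs_sigmaKernel_le_native`** (`|p₁ − p₂|_∞ ≥ 4δ/a + 2 ⟹ |σ_k(p₁,p₂)| ≤ (4M²M_C·d²e^{a/2}K(a)²·(d+1)!/a^{d+1})·e^{−(a/2)|p₁−p₂|_∞}`,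
  `a = min(δ,δ_C)/2`, at `w = η^d`, `c = η⁻¹`), **`decay216_native_eta`** (`pdist` three-constant shape), **`decay216_native_of_ineq722`**
  (H-input from r15's typed `KernelData.Ineq722` for p09's torus kernel family; C-input = (7.2.3) for the NATIVE matrices `CE P η_j^d L^j j`,
  ALL `j ≤ m + K`, one `(M_C, δ_C)` — ONE triple `(R₀, c₀, δ′)` for all `k ≤ m + K`), `decay216_native_of_ineq723` (the C-input phrased as
  r15's typed `KernelData.Ineq723` for p09's carrier with `C :=` the native matrix), **`decay216_native_of_prop12`** (H-input from `B5.Prop12Printed`).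
* §3 **(2.17) ON THE TORI WITH (2.16) DISCHARGED FROM THE NATIVE (7.2.3)**: **`ineq217_native_of_prop12`** (p08's
  `abs_ineq217_ineq722_torus` fed with §2).
* §4 (v1.1) **(2.18)–(2.19) ON THE TORI WITH (2.16) DISCHARGED FROM THE NATIVE (7.2.3)**: **`close218_native_of_prop12`** (p08's
  `close_trunc_of_decay3` fed with §2: `Close pdist σ_{k,loc} σ_k (c₀e^{−(δ′/2)R}) (δ′/2)` for every `k ≤ m + K` and `R ≥ R₀`),
  **`ineq219_native_of_prop12`** (r18's `Ineq219 σ_{k,loc} (c711(d))` for every `k ≤ m + K` and truncation radius `R ≥ R₁`, ONE `R₁` —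
  p08's `ineq219_sigmaKernel_eta` ([I] Thm. 7.1.1 at the physical weight) + p02's `ineq219_of_close`; re-run of p08's p262770 §3).
HONEST SCOPE.  (i) (7.2.3) enters as a hypothesis on the matrices of the unit-lattice propagators `CE P η_j^d L^j j` (row C1.Eq7.2.3 has no
torus proof in the tree), uniformly in `j` exactly as printed *"uniformly in k"*; [6I] Proposition 1.2 enters by its tree name as in row
C1.Eq7.2.1-7.2.2's own files.  (ii) Constants explicit, not optimal; thresholds in the `ℓ^∞` block distance, restated in `pdist`.  (iii) `U = 1`
real abelian fields; torus (periodic b.c.); standing range.  (iv) No `def`, no new named fact, nothing restated: theorems only; NOT summit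
progress.  Unit `lit-balaban-r18` (literature-prover-lit-balaban-r18-g8-0), 2026-08-21.
-/

open scoped BigOperators RealInnerProductSpace

namespace Literature.MathematicalPhysics.QuantumFieldTheory.BalabanImbrieJaffe1984to88.BIJ88Decay216Native

open Balaban1983to89 hiding Site Plaq
open Balaban1983to89.LatticeFieldCalculus
open Balaban1983to89.B3TorusRadialSums (tdist_le_mul_supDist supDist_eq_zero_iff)
open Balaban1983to89.T4AxialGaugeSmallField (castSite boxPlaqs)
open BIJ88SigmaKernelDkTorus BIJ88Ineq217Ineq722Torus BIJ88Ineq217NearPart BIJ88Decay216Torus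
open BIJ88Sect2Statements (supNorm)
open BIJ88Close235Proof (supNorm_nonneg)
open BIJ85AxialPropagator411 BIJ85Prop521Torus BIJ85Prop521Proof BIJ85Sigma421Torus BIJ85Prop522Torus BIJ85Sigma422Eta
open BIJ85Sect7Statements BIJ85Ineq722Torus BIJ85Eq721MinimizerKernel
open BIJ85Ineq722ProofPart2 (settingOf)
open BIJ85Ineq722DeltaA (deltaAData ineq722_deltaA_of_prop12Printed)
open BIJ85SigmaTorusScaling (curlOp_eq_smul)
open BIJ88Sect2Statements (Ineq219 Close trunc)
open BIJ88Close218Proof (ineq219_of_close)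
open BIJ88Ineq219SigmaTorus (pdist_comm)
open BIJ88Ineq219TorusProp12 (ineq219_sigmaKernel_eta ineq219_mono close_trunc_of_decay3)
open BIJ85SigmaClosedCube (c711 c711_pos)
-- inside this namespace the bare `Site`/`Plaq` are the `ℤ^d` carriers of the QFT root; the torus ones are renamed:
open Balaban1983to89 renaming Site → TSite, Plaq → TPlaq

noncomputable section

/-! ## §1  The rescaling dictionary: `C^{(j)}` on the `L^jη` lattice versus the unit lattice -/

section Scaling

variable {E F : Type*} [NormedAddCommGroup E] [InnerProductSpace ℝ E] [FiniteDimensional ℝ E]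
  [NormedAddCommGroup F] [InnerProductSpace ℝ F] [FiniteDimensional ℝ F]

/-- `Ring.inverse (t • X) = t⁻¹ • Ring.inverse X` for a nonzero real scalar (both sides vanish when `X` is not a unit). [folklore] -/
private theorem ringInverse_smul {A : Type*} [Ring A] [Algebra ℝ A] {t : ℝ} (ht : t ≠ 0) (X : A) :
    Ring.inverse (t • X) = t⁻¹ • Ring.inverse X := by
  by_cases hX : IsUnit X
  · obtain ⟨u, rfl⟩ := hX
    have hmul : (t • (u : A)) * (t⁻¹ • ((u⁻¹ : Aˣ) : A)) = 1 := by
      rw [smul_mul_smul_comm, mul_inv_cancel₀ ht, one_smul, Units.mul_inv]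
    have hmul' : (t⁻¹ • ((u⁻¹ : Aˣ) : A)) * (t • (u : A)) = 1 := by
      rw [smul_mul_smul_comm, inv_mul_cancel₀ ht, one_smul, Units.inv_mul]
    have hu : IsUnit (t • (u : A)) := isUnit_iff_exists.2 ⟨_, hmul, hmul'⟩
    obtain ⟨v, hv⟩ := hu
    rw [← hv, Ring.inverse_unit, Ring.inverse_unit]
    rw [← hv] at hmul
    exact Units.inv_eq_of_mul_eq_one_right hmul
  · have hX' : ¬IsUnit (t • X) := by
      intro h
      apply hX
      obtain ⟨v, hv⟩ := h
      have hmul : (t⁻¹ • (v : A)) * (t • ((v⁻¹ : Aˣ) : A)) = 1 := by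
        rw [smul_mul_smul_comm, inv_mul_cancel₀ ht, one_smul, Units.mul_inv]
      have hmul' : (t • ((v⁻¹ : Aˣ) : A)) * (t⁻¹ • (v : A)) = 1 := by
        rw [smul_mul_smul_comm, mul_inv_cancel₀ ht, one_smul, Units.inv_mul]
      have e : t⁻¹ • (v : A) = X := by rw [hv, smul_smul, inv_mul_cancel₀ ht, one_smul]
      rw [← e]
      exact isUnit_iff_exists.2 ⟨_, hmul, hmul'⟩
    rw [Ring.inverse_non_unit _ hX, Ring.inverse_non_unit _ hX', smul_zero]

/-- the adjoint of a real scalar multiple: `(s•S)* = s•S*`. [folklore] -/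
private theorem adjoint_smul' (s : ℝ) (S : E →ₗ[ℝ] F) : LinearMap.adjoint (s • S) = s • LinearMap.adjoint S := by
  rw [LinearEquiv.map_smulₛₗ LinearMap.adjoint s S, starRingEnd_apply, star_trivial]

/-- `(sS)*(sS) = s²·S*S` (p09's `formOp`). [cite: BalabanImbrieJaffe1985, (4.1.1) p.309] -/
theorem formOp_smul (s : ℝ) (S : E →ₗ[ℝ] F) : formOp (s • S) = s ^ 2 • formOp S := by
  unfold formOp
  rw [adjoint_smul', LinearMap.smul_comp, LinearMap.comp_smul, smul_smul, sq]

/-- `((sS)*(sS))⁻¹ = s⁻²·(S*S)⁻¹` (p09's `formInv`, `s ≠ 0`). [cite: BalabanImbrieJaffe1985, (4.1.1) p.309] -/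
theorem formInv_smul {s : ℝ} (hs : s ≠ 0) (S : E →ₗ[ℝ] F) : formInv (s • S) = (s ^ 2)⁻¹ • formInv S := by
  unfold formInv
  rw [formOp_smul, ringInverse_smul (pow_ne_zero 2 hs)]

/-- **the axial propagator of a rescaled `∂` **: `G_{Ax}[s∂] = s⁻²·G_{Ax}[∂]` for p09's operator formula
`axialPropagator V D = ι_V (ι_V* D*D ι_V)⁻¹ ι_V*` of (4.1.1) (`s ≠ 0`). [cite: BalabanImbrieJaffe1985, (4.1.1) p.309] -/
theorem axialPropagator_smul (V : Submodule ℝ E) (D : E →ₗ[ℝ] F) {s : ℝ} (hs : s ≠ 0) :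
    axialPropagator V (s • D) = (s ^ 2)⁻¹ • axialPropagator V D := by
  unfold axialPropagator
  rw [LinearMap.smul_comp, formInv_smul hs, LinearMap.smul_comp, LinearMap.comp_smul]

/-- **the axial minimizer does not see the normalisation of `∂`**: `HaxOp V (s∂) Q^{s*} = HaxOp V ∂ Q^{s*}` (p30's (4.1.3)/(5.3.1) linear
minimizer `Q^{s*} − G_{Ax}∂*∂Q^{s*}`; `s ≠ 0`). [cite: BalabanImbrieJaffe1985, (4.1.3) p.310] -/
theorem haxOp_smul {Ec : Type*} [NormedAddCommGroup Ec] [InnerProductSpace ℝ Ec] [FiniteDimensional ℝ Ec]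
    (V : Submodule ℝ E) (D : E →ₗ[ℝ] F) (Qs : Ec →ₗ[ℝ] E) {s : ℝ} (hs : s ≠ 0) :
    HaxOp V (s • D) Qs = HaxOp V D Qs := by
  unfold HaxOp
  have h3 : (s • LinearMap.adjoint D) ∘ₗ (s • D) ∘ₗ Qs = (s ^ 2) • (LinearMap.adjoint D ∘ₗ D ∘ₗ Qs) := by
    simp only [LinearMap.smul_comp, LinearMap.comp_smul, smul_smul, sq]
  rw [axialPropagator_smul V D hs, adjoint_smul', h3, LinearMap.comp_smul, LinearMap.smul_comp, smul_smul,
    mul_inv_cancel₀ (pow_ne_zero 2 hs), one_smul]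

end Scaling

variable {P : Params}

/-- `0 < L^k` in `ℝ`. [folklore] -/
private theorem cast_pow_L_pos'' (k : ℕ) : (0 : ℝ) < (P.L : ℝ) ^ k := pow_pos P.cast_L_pos k

/-- **the axial minimizer `H_{j,Ax}` of the tree does not depend on the weights** `(w, c)` of `∂ = √w·∂^{c}` (`w > 0`, `c ≠ 0`):
`HaxE P w c j = HaxE P 1 1 j`. [cite: BalabanImbrieJaffe1985, (4.1.3) p.310] -/
theorem haxE_eq_haxE_one {w c : ℝ} (hw : 0 < w) (hc : c ≠ 0) (j : ℕ) : HaxE P w c j = HaxE P 1 1 j := by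
  have hs : Real.sqrt w * c ≠ 0 := mul_ne_zero (Real.sqrt_pos.2 hw).ne' hc
  unfold HaxE
  rw [curlOp_eq_smul w c, haxOp_smul _ _ _ hs]

/-- **THE PROPAGATOR `C^{(j)}` OF THE TREE IS HOMOGENEOUS OF DEGREE `−1` IN `w·c²`**: `CE P w c j = (w·c²)⁻¹ • CE P 1 1 j` (`w > 0`,
`c ≠ 0`) — the covariance of `exp(−½‖√w·∂^{c}H_{j,Ax}B‖²)` on `δ(QB)δ_{Ax}(B)`. [cite: BalabanImbrieJaffe1985, (4.3.3) p.311] -/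
theorem cE_eq_smul_cE_one {w c : ℝ} (hw : 0 < w) (hc : c ≠ 0) (j : ℕ) : CE P w c j = (w * c ^ 2)⁻¹ • CE P 1 1 j := by
  have hs : Real.sqrt w * c ≠ 0 := mul_ne_zero (Real.sqrt_pos.2 hw).ne' hc
  unfold CE
  rw [haxE_eq_haxE_one hw hc, curlOp_eq_smul w c, LinearMap.smul_comp, axialPropagator_smul _ _ hs, mul_pow, Real.sq_sqrt hw.le]

/-- at the normalisation of step `k` (`w = η^d = L^{−kd}`, `c = η⁻¹ = L^k`): `CE P η_k^d L^k j = (L^k)^{d−2} • CE P 1 1 j` (`d ≥ 2`).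
[cite: BalabanImbrieJaffe1985, (4.4.4) p.312] -/
theorem cE_eta_eq (hd : 2 ≤ P.d) (j k : ℕ) :
    CE P ((P.eta k) ^ P.d) ((P.L : ℝ) ^ k) j = (((P.L : ℝ) ^ k) ^ (P.d - 2)) • CE P 1 1 j := by
  have hL : (P.L : ℝ) ^ k ≠ 0 := (cast_pow_L_pos'' k).ne'
  have he : P.eta k = ((P.L : ℝ) ^ k)⁻¹ := by rw [Params.eta, inv_pow]
  rw [cE_eq_smul_cE_one (pow_pos (eta_pos P k) _) hL j, he, inv_pow, mul_inv, inv_inv, ← pow_sub₀ _ hL hd]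

/-- **[I] (4.4.4)'s `C^{(j)}` "on the `L^jη` lattice" VERSUS THE UNIT-LATTICE `C^{(j)}` OF (4.3.3)/(7.2.3)**: for `j ≤ k`,
`CE P η_k^d L^k j = (L^{k−j})^{d−2} • CE P η_j^d L^j j` — the canonical scaling factor of a propagator of dimension (length)^{2−d} rescaled
from spacing `1` to spacing `L^{j−k}` (C2 (2.12): *"Superscripts L^jη, η, etc. indicate the lattice spacing for operators rescaled to
nonstandard lattices"*). [cite: BalabanImbrieJaffe1988, (2.12) p.261] -/
theorem cE_ambient_eq_native (hd : 2 ≤ P.d) {j k : ℕ} (hjk : j ≤ k) :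
    CE P ((P.eta k) ^ P.d) ((P.L : ℝ) ^ k) j = (((P.L : ℝ) ^ (k - j)) ^ (P.d - 2)) • CE P ((P.eta j) ^ P.d) ((P.L : ℝ) ^ j) j := by
  rw [cE_eta_eq hd j k, cE_eta_eq hd j j, smul_smul, ← mul_pow, ← pow_add, Nat.sub_add_cancel hjk]

/-- at `d = 2` the rescaled and the unit-lattice `C^{(j)}` COINCIDE (`w·c² = η²·η⁻² = 1` at every scale).
[cite: BalabanImbrieJaffe1988, (2.12) p.261] -/
theorem cE_ambient_eq_native_two (hd2 : P.d = 2) {j k : ℕ} (hjk : j ≤ k) :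
    CE P ((P.eta k) ^ P.d) ((P.L : ℝ) ^ k) j = CE P ((P.eta j) ^ P.d) ((P.L : ℝ) ^ j) j := by
  rw [cE_ambient_eq_native (le_of_eq hd2.symm) hjk, hd2, Nat.sub_self, pow_zero, one_smul]

/-- matrix entries: `⟨e_b, C^{(j),L^jη}e_{b′}⟩ = (L^{k−j})^{d−2}·⟨e_b, C^{(j)}e_{b′}⟩`. [cite: BalabanImbrieJaffe1988, (2.12) p.261] -/
theorem inner_cE_ambient_eq (hd : 2 ≤ P.d) {j k : ℕ} (hjk : j ≤ k) (b b' : PBond P j) :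
    ⟪toEj P j (Pi.single b 1), CE P ((P.eta k) ^ P.d) ((P.L : ℝ) ^ k) j (toEj P j (Pi.single b' 1))⟫ =
      ((P.L : ℝ) ^ (k - j)) ^ (P.d - 2) *
        ⟪toEj P j (Pi.single b 1), CE P ((P.eta j) ^ P.d) ((P.L : ℝ) ^ j) j (toEj P j (Pi.single b' 1))⟫ := by
  rw [cE_ambient_eq_native hd hjk, LinearMap.smul_apply, real_inner_smul_right]

/-- **(7.2.3) for the unit-lattice `C^{(j)}` gives the (7.2.3)-SHAPE bound for the rescaled `C^{(j),L^jη}` with the constant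
`M_C·(L^{k−j})^{d−2}`** — the extra *"scaling factor"* of the p. 261 bracket at `d ≥ 3` (none at `d = 2`).
[cite: BalabanImbrieJaffe1988, (2.16) p.261] -/
theorem abs_inner_cE_ambient_le (hd : 2 ≤ P.d) {j k : ℕ} (hjk : j ≤ k) {MC δC : ℝ}
    (hC : ∀ b b' : PBond P j, |⟪toEj P j (Pi.single b 1),
      CE P ((P.eta j) ^ P.d) ((P.L : ℝ) ^ j) j (toEj P j (Pi.single b' 1))⟫| ≤ MC * Real.exp (-(δC * (supDist b.src b'.src : ℝ)))) :
    ∀ b b' : PBond P j, |⟪toEj P j (Pi.single b 1),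
      CE P ((P.eta k) ^ P.d) ((P.L : ℝ) ^ k) j (toEj P j (Pi.single b' 1))⟫| ≤
        MC * ((P.L : ℝ) ^ (k - j)) ^ (P.d - 2) * Real.exp (-(δC * (supDist b.src b'.src : ℝ))) := by
  intro b b'
  have hℓ : 0 < ((P.L : ℝ) ^ (k - j)) ^ (P.d - 2) := pow_pos (cast_pow_L_pos'' _) _
  rw [inner_cE_ambient_eq hd hjk, abs_mul, abs_of_pos hℓ]
  calc ((P.L : ℝ) ^ (k - j)) ^ (P.d - 2) *
        |⟪toEj P j (Pi.single b 1), CE P ((P.eta j) ^ P.d) ((P.L : ℝ) ^ j) j (toEj P j (Pi.single b' 1))⟫|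
      ≤ ((P.L : ℝ) ^ (k - j)) ^ (P.d - 2) * (MC * Real.exp (-(δC * (supDist b.src b'.src : ℝ)))) :=
        mul_le_mul_of_nonneg_left (hC b b') hℓ.le
    _ = MC * ((P.L : ℝ) ^ (k - j)) ^ (P.d - 2) * Real.exp (-(δC * (supDist b.src b'.src : ℝ))) := by ring

/-! ## §2  (2.16) on the tori from the gradient member of (7.2.2) and the NATIVE (7.2.3) -/

/-- **the scaling factor against the scale-`j` decay, any power**: `x^q·e^{−ax} ≤ (q+1)!/(a^{q+1}x)` (`a, x > 0`; `y^{q+1}/(q+1)! ≤ e^y`).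
[folklore] -/
private theorem pow_mul_exp_neg_le {a x : ℝ} (ha : 0 < a) (hx : 0 < x) (q : ℕ) :
    x ^ q * Real.exp (-(a * x)) ≤ ((q + 1).factorial : ℝ) / (a ^ (q + 1) * x) := by
  have h := Real.pow_div_factorial_le_exp (a * x) (by positivity) (q + 1)
  rw [div_le_iff₀ (by positivity)] at h
  rw [le_div_iff₀ (by positivity)]
  calc x ^ q * Real.exp (-(a * x)) * (a ^ (q + 1) * x) = (a * x) ^ (q + 1) * Real.exp (-(a * x)) := by ring
    _ ≤ Real.exp (a * x) * ((q + 1).factorial : ℝ) * Real.exp (-(a * x)) := mul_le_mul_of_nonneg_right h (Real.exp_pos _).le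
    _ = ((q + 1).factorial : ℝ) := by
        rw [mul_comm (Real.exp _), mul_assoc, ← Real.exp_add, add_neg_cancel, Real.exp_zero, mul_one]

/-- `Σ_{j<k} L^{−(k−j)} ≤ 1` (`L ≥ 2`; p08's private lemma, re-proved). [folklore] -/
private theorem sum_inv_pow_le_one' (k : ℕ) : ∑ j ∈ Finset.range k, ((P.L : ℝ) ^ (k - j))⁻¹ ≤ 1 := by
  have hL1 : (1 : ℝ) < P.L := by exact_mod_cast P.hL.2
  have hL0 : (0 : ℝ) < P.L := by linarith
  set x : ℝ := (P.L : ℝ)⁻¹ with hx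
  have hx0 : 0 ≤ x := by rw [hx]; positivity
  have hx1 : x < 1 := by rw [hx]; exact inv_lt_one_of_one_lt₀ hL1
  have hx2 : x ≤ 1 / 2 := by
    rw [hx]
    have : (2 : ℝ) ≤ P.L := by exact_mod_cast P.hL.2
    exact (inv_le_inv₀ hL0 two_pos).2 this |>.trans (by norm_num)
  have hre : ∑ j ∈ Finset.range k, ((P.L : ℝ) ^ (k - j))⁻¹ = ∑ i ∈ Finset.range k, x ^ (i + 1) := by
    rw [← Finset.sum_range_reflect]
    refine Finset.sum_congr rfl fun i hi => ?_
    rw [Finset.mem_range] at hi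
    rw [hx, inv_pow, show k - (k - 1 - i) = i + 1 by omega]
  rw [hre]
  have hgeom : ∑ i ∈ Finset.range k, x ^ (i + 1) = x * ((x ^ k - 1) / (x - 1)) := by
    rw [← geom_sum_eq hx1.ne k, Finset.mul_sum]
    exact Finset.sum_congr rfl fun i _ => by ring
  rw [hgeom]
  have h1x : 0 < 1 - x := by linarith
  have hxk : 0 ≤ x ^ k := pow_nonneg hx0 k
  rw [show (x ^ k - 1) / (x - 1) = (1 - x ^ k) / (1 - x) by
    rw [← neg_sub 1 (x ^ k), ← neg_sub 1 x, neg_div_neg_eq]]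
  rw [← mul_div_assoc, div_le_one h1x]
  nlinarith

/-- `L^k = L^j·L^{k−j}` for `j ≤ k`. [folklore] -/
private theorem pow_eq_pow_mul_pow' {j k : ℕ} (hjk : j ≤ k) : (P.L : ℝ) ^ k = (P.L : ℝ) ^ j * (P.L : ℝ) ^ (k - j) := by
  rw [← pow_add, Nat.add_sub_cancel' hjk]

/-- `|p₁ − p₂|_∞ > 0 ⇒ p₁ ≠ p₂`. [folklore] -/
private theorem ne_of_supDist_pos' {k : ℕ} {p₁ p₂ : TPlaq P k} (h : 0 < supDist p₁.src p₂.src) : p₁ ≠ p₂ := by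
  rintro rfl
  rw [(supDist_eq_zero_iff _ _).2 rfl] at h
  exact lt_irrefl 0 h

/-- **(2.16) ON THE TORI FROM (7.2.2) AND THE NATIVE (7.2.3), `ℓ^∞` block distance, explicit constants, every `d ≥ 2`**: for p30's
`σ_k = sigmaTorus hd η^d η⁻¹ k` and unit plaquettes `p₁, p₂` with `D := |p₁₋ − p₂₋|_∞ ≥ 4δ/a + 2` (`a = min(δ, δ_C)/2`):
`|σ_k(p₁, p₂)| ≤ (4M²M_C·d²e^{a/2}K(a)²·(d+1)!/a^{d+1})·e^{−(a/2)D}` — given the gradient member of (7.2.2) for every `H_j`, `j < k`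
(constants `δ, M`, native at scale `j` as in p09's carrier) and (7.2.3) FOR THE UNIT-LATTICE MATRICES `⟨e_b, CE P η_j^d L^j j e_{b′}⟩`,
`j < k` (constants `δ_C, M_C ≥ 0`): p08's scale-`j` term `abs_term_le` is fed the rescaled constant `M_C·(L^{k−j})^{d−2}` of §1, so it
carries `(L^{k−j})^{2+(d−2)} = (L^{k−j})^d` against `e^{2δL^{k−j}}e^{−aL^{k−j}D} ≤ e^{−aL^{k−j}}e^{−(a/2)D}`, and `(Lⁿ)^d e^{−aLⁿ} ≤
(d+1)!/(a^{d+1}Lⁿ)`, `Σ_{j<k}L^{−(k−j)} ≤ 1` — *"[The rapid decay of the terms with small j compensates for the scaling factors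
(L^jη)^{−1}.]"*. [cite: BalabanImbrieJaffe1988, (2.16) p.261] -/
theorem abs_sigmaKernel_le_native (hd : 2 ≤ P.d) {k : ℕ} (hk : k ≤ P.m + P.K) {a : ℝ} (ha : 0 < a)
    {δ M δC MC : ℝ} (hδ : 0 < δ) (hδC : 0 < δC) (hMC : 0 ≤ MC)
    (hB : ∀ (j : ℕ) (hj : j ≤ P.m + P.K), j < k → ∀ (μ ν : Fin P.d) (x : TSite P 0) (y : TSite P j),
      ‖fun lam : Fin P.d => (P.L : ℝ) ^ j *
          ((torusRep P j (deltaAData hj a)).H (x.shift lam, μ) (y, ν) - (torusRep P j (deltaAData hj a)).H (x, μ) (y, ν))‖ ≤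
        M * Real.exp (-(δ * distEU P j x y)))
    (hC : ∀ j < k, ∀ b b' : PBond P j, |⟪toEj P j (Pi.single b 1),
      CE P ((P.eta j) ^ P.d) ((P.L : ℝ) ^ j) j (toEj P j (Pi.single b' 1))⟫| ≤ MC * Real.exp (-(δC * (supDist b.src b'.src : ℝ))))
    {p₁ p₂ : TPlaq P k} (hD : 4 * δ / (min δ δC / 2) + 2 ≤ (supDist p₁.src p₂.src : ℝ)) :
    |sigmaTorus (P := P) hd ((P.eta k) ^ P.d) ((P.L : ℝ) ^ k) k (toU P k (Pi.single p₂ 1)) p₁| ≤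
      4 * M ^ 2 * MC * ((P.d : ℝ) ^ 2 * (Real.exp (min δ δC / 2 / 2) * ((2 * (1 + P.d / (min δ δC / 2))) ^ P.d) ^ 2)) *
          (((P.d + 1).factorial : ℝ) / (min δ δC / 2) ^ (P.d + 1)) *
        Real.exp (-(min δ δC / 2 / 2 * (supDist p₁.src p₂.src : ℝ))) := by
  set a₀ : ℝ := min δ δC / 2 with ha₀
  have ha₀p : 0 < a₀ := by rw [ha₀]; exact half_pos (lt_min hδ hδC)
  set D : ℝ := (supDist p₁.src p₂.src : ℝ) with hDdef
  set K : ℝ := (P.d : ℝ) ^ 2 * (Real.exp (a₀ / 2) * ((2 * (1 + P.d / a₀)) ^ P.d) ^ 2) with hK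
  have hK0 : 0 ≤ K := by positivity
  have hD0 : 0 ≤ D := Nat.cast_nonneg _
  have hD' : 4 * δ + 2 * a₀ ≤ a₀ * D := by
    have h := mul_le_mul_of_nonneg_left hD ha₀p.le
    have e : a₀ * (4 * δ / a₀ + 2) = 4 * δ + 2 * a₀ := by field_simp
    linarith
  have hLk : (P.L : ℝ) ^ k ≠ 0 := (cast_pow_L_pos'' k).ne'
  have hw : 0 < (P.eta k) ^ P.d := pow_pos (eta_pos P k) _
  have hW : (P.eta k) ^ P.d * ((P.eta k)⁻¹) ^ P.d = 1 := eta_pow_mul_eta_inv_pow P k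
  -- `p₁ ≠ p₂`
  have hDpos : 0 < supDist p₁.src p₂.src := by
    have h : (0 : ℝ) < (supDist p₁.src p₂.src : ℝ) := lt_of_lt_of_le (by positivity) hD
    exact_mod_cast h
  have hne : p₁ ≠ p₂ := ne_of_supDist_pos' hDpos
  rw [sigmaKernel_offDiag_eq_sum hd hk hLk hw hne, abs_neg]
  -- the scale-`j` term against the scaling factors
  have hterm : ∀ j ∈ Finset.range k,
      |∑ b : PBond P j, ∑ b' : PBond P j,
        LinearMap.adjoint (HkE P ((P.eta k) ^ P.d) ((P.L : ℝ) ^ k) j)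
            (LinearMap.adjoint (curlOp (P := P) ((P.eta k) ^ P.d) ((P.L : ℝ) ^ k))
              (QesOp (P := P) hd ((P.eta k) ^ P.d) k (toU P k (Pi.single p₁ 1)))) b *
          ⟪toEj P j (Pi.single b 1), CE P ((P.eta k) ^ P.d) ((P.L : ℝ) ^ k) j (toEj P j (Pi.single b' 1))⟫ *
          LinearMap.adjoint (HkE P ((P.eta k) ^ P.d) ((P.L : ℝ) ^ k) j)
            (LinearMap.adjoint (curlOp (P := P) ((P.eta k) ^ P.d) ((P.L : ℝ) ^ k))
              (QesOp (P := P) hd ((P.eta k) ^ P.d) k (toU P k (Pi.single p₂ 1)))) b'| ≤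
        4 * M ^ 2 * MC * K *
          ((((P.d + 1).factorial : ℝ) / (a₀ ^ (P.d + 1) * (P.L : ℝ) ^ (k - j))) * Real.exp (-(a₀ / 2 * D))) := by
    intro j hjm
    have hjk : j < k := Finset.mem_range.1 hjm
    have hj : j ≤ P.m + P.K := by omega
    refine (abs_term_le hd hk hj hjk.le hLk hw ha hδ hδC (hB j hj hjk)
      (abs_inner_cE_ambient_le hd hjk.le (hC j hjk)) p₁ p₂).trans ?_
    set ℓ : ℝ := (P.L : ℝ) ^ (k - j) with hℓ
    have hℓ1 : 1 ≤ ℓ := one_le_pow₀ (by exact_mod_cast P.L_pos)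
    have hℓ0 : 0 < ℓ := by linarith
    have hcj : |(P.L : ℝ) ^ k| / (P.L : ℝ) ^ j = ℓ := by
      rw [abs_of_pos (cast_pow_L_pos'' k), pow_eq_pow_mul_pow' hjk.le, ← hℓ, mul_div_cancel_left₀ _ (cast_pow_L_pos'' j).ne']
    have h1 : ((P.eta k) ^ P.d * ((P.eta k)⁻¹) ^ P.d * (|(P.L : ℝ) ^ k| / (P.L : ℝ) ^ j * (2 * M) * Real.exp (δ * ℓ))) ^ 2 *
          (MC * ℓ ^ (P.d - 2)) * K * Real.exp (-(a₀ * (ℓ * D))) =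
        4 * M ^ 2 * MC * K *
          (ℓ ^ 2 * ℓ ^ (P.d - 2) * (Real.exp (δ * ℓ) * Real.exp (δ * ℓ) * Real.exp (-(a₀ * (ℓ * D))))) := by
      rw [hW, hcj]; ring
    have h2 : Real.exp (δ * ℓ) * Real.exp (δ * ℓ) * Real.exp (-(a₀ * (ℓ * D))) ≤
        Real.exp (-(a₀ * ℓ)) * Real.exp (-(a₀ / 2 * D)) := by
      rw [← Real.exp_add, ← Real.exp_add, ← Real.exp_add]
      refine Real.exp_le_exp.2 ?_
      have h3 := mul_le_mul_of_nonneg_left hD' (show (0 : ℝ) ≤ ℓ - 1 / 2 by linarith)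
      have e1 : a₀ * (ℓ * D) = ℓ * (a₀ * D) := by ring
      rw [e1]
      nlinarith [h3, hℓ1, hδ.le, ha₀p.le, hD0, mul_nonneg ha₀p.le hD0]
    have h3 : ℓ ^ 2 * ℓ ^ (P.d - 2) = ℓ ^ P.d := by rw [← pow_add, Nat.add_sub_cancel' hd]
    have h4 : ℓ ^ P.d * Real.exp (-(a₀ * ℓ)) ≤ ((P.d + 1).factorial : ℝ) / (a₀ ^ (P.d + 1) * ℓ) :=
      pow_mul_exp_neg_le ha₀p hℓ0 P.d
    rw [h1, h3]
    refine mul_le_mul_of_nonneg_left ?_ (by positivity)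
    calc ℓ ^ P.d * (Real.exp (δ * ℓ) * Real.exp (δ * ℓ) * Real.exp (-(a₀ * (ℓ * D))))
        ≤ ℓ ^ P.d * (Real.exp (-(a₀ * ℓ)) * Real.exp (-(a₀ / 2 * D))) := mul_le_mul_of_nonneg_left h2 (by positivity)
      _ = ℓ ^ P.d * Real.exp (-(a₀ * ℓ)) * Real.exp (-(a₀ / 2 * D)) := by ring
      _ ≤ ((P.d + 1).factorial : ℝ) / (a₀ ^ (P.d + 1) * ℓ) * Real.exp (-(a₀ / 2 * D)) :=
          mul_le_mul_of_nonneg_right h4 (Real.exp_pos _).le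
  calc _ ≤ ∑ j ∈ Finset.range k, 4 * M ^ 2 * MC * K *
          ((((P.d + 1).factorial : ℝ) / (a₀ ^ (P.d + 1) * (P.L : ℝ) ^ (k - j))) * Real.exp (-(a₀ / 2 * D))) :=
        (Finset.abs_sum_le_sum_abs _ _).trans (Finset.sum_le_sum hterm)
    _ = 4 * M ^ 2 * MC * K * (((P.d + 1).factorial : ℝ) / a₀ ^ (P.d + 1)) * Real.exp (-(a₀ / 2 * D)) *
          ∑ j ∈ Finset.range k, ((P.L : ℝ) ^ (k - j))⁻¹ := by
        rw [Finset.mul_sum]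
        refine Finset.sum_congr rfl fun j _ => ?_
        field_simp
    _ ≤ 4 * M ^ 2 * MC * K * (((P.d + 1).factorial : ℝ) / a₀ ^ (P.d + 1)) * Real.exp (-(a₀ / 2 * D)) * 1 :=
        mul_le_mul_of_nonneg_left (sum_inv_pow_le_one' k) (by positivity)
    _ = _ := by rw [mul_one]

/-- **(2.16) ON THE TORI AT THE PRINTED NORMALISATION FROM THE NATIVE (7.2.3)**, in the `ℓ¹` distance `pdist` and the three-constant shape
`R₀ ≤ pdist p₁ p₂ → |σ_k(p₁,p₂)| ≤ c₀e^{−δ′·pdist p₁ p₂}` consumed by the (2.17) files: for `pdist p₁ p₂ ≥ d(4δ/a + 2)`,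
`|σ_k(p₁, p₂)| ≤ (4M²M_C·d²e^{a/2}K(a)²(d+1)!/a^{d+1})·e^{−(a/(2d))·pdist p₁ p₂}`, `a = min(δ, δ_C)/2`; constants INDEPENDENT of `k` and of
the volume, every `d ≥ 2`. [cite: BalabanImbrieJaffe1988, (2.16) p.261] -/
theorem decay216_native_eta (hd : 2 ≤ P.d) {k : ℕ} (hk : k ≤ P.m + P.K) {a : ℝ} (ha : 0 < a) {δ M δC MC : ℝ} (hδ : 0 < δ)
    (hδC : 0 < δC) (hMC : 0 ≤ MC)
    (hB : ∀ (j : ℕ) (hj : j ≤ P.m + P.K), j < k → ∀ (μ ν : Fin P.d) (x : TSite P 0) (y : TSite P j),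
      ‖fun lam : Fin P.d => (P.L : ℝ) ^ j *
          ((torusRep P j (deltaAData hj a)).H (x.shift lam, μ) (y, ν) - (torusRep P j (deltaAData hj a)).H (x, μ) (y, ν))‖ ≤
        M * Real.exp (-(δ * distEU P j x y)))
    (hC : ∀ j < k, ∀ b b' : PBond P j, |⟪toEj P j (Pi.single b 1),
      CE P ((P.eta j) ^ P.d) ((P.L : ℝ) ^ j) j (toEj P j (Pi.single b' 1))⟫| ≤ MC * Real.exp (-(δC * (supDist b.src b'.src : ℝ))))
    (p₁ p₂ : TPlaq P k) (hfar : (P.d : ℝ) * (4 * δ / (min δ δC / 2) + 2) ≤ pdist p₁ p₂) :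
    |sigmaTorus (P := P) hd ((P.eta k) ^ P.d) ((P.L : ℝ) ^ k) k (toU P k (Pi.single p₂ 1)) p₁| ≤
      (4 * M ^ 2 * MC * ((P.d : ℝ) ^ 2 * (Real.exp (min δ δC / 2 / 2) * ((2 * (1 + P.d / (min δ δC / 2))) ^ P.d) ^ 2)) *
          (((P.d + 1).factorial : ℝ) / (min δ δC / 2) ^ (P.d + 1))) *
        Real.exp (-(min δ δC / 2 / 2 / P.d) * pdist p₁ p₂) := by
  have hd0 : (0 : ℝ) < P.d := by exact_mod_cast P.hd
  -- `ℓ¹ ≤ d·ℓ^∞`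
  have h1 : pdist p₁ p₂ ≤ (P.d : ℝ) * (supDist p₁.src p₂.src : ℝ) := by
    unfold pdist
    exact_mod_cast tdist_le_mul_supDist p₁.src p₂.src
  have hD : 4 * δ / (min δ δC / 2) + 2 ≤ (supDist p₁.src p₂.src : ℝ) :=
    le_of_mul_le_mul_left (hfar.trans h1) hd0
  have h := abs_sigmaKernel_le_native hd hk ha hδ hδC hMC hB hC hD
  refine h.trans (mul_le_mul_of_nonneg_left (Real.exp_le_exp.2 ?_) (by positivity))
  have ha₀ : 0 < min δ δC / 2 := half_pos (lt_min hδ hδC)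
  rw [neg_mul, neg_le_neg_iff, div_mul_eq_mul_div, div_le_iff₀ hd0]
  nlinarith [mul_le_mul_of_nonneg_left h1 (half_pos ha₀).le]

/-- **(2.16) ON THE TORI FROM THE TYPED (7.2.2) AND THE NATIVE (7.2.3), CONSTANTS UNIFORM IN `k`**: given r15's typed
`KernelData.Ineq722` for p09's torus kernel family `i ↦ torusKernelData P (lev i) (deltaAData …) …` whose scales cover the standing range,
and (7.2.3) for the UNIT-LATTICE matrices `⟨e_b, CE P η_j^d L^j j e_{b′}⟩` at EVERY scale `j ≤ m + K` with one pair `(M_C, δ_C)` —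
verbatim [I] (4.3.5)/(7.2.3) *"uniformly in k"* — THERE ARE `R₀, c₀, δ′ > 0` such that FOR EVERY `k ≤ m + K` the kernel of p30's `σ_k`
(printed normalisation) satisfies `|σ_k(p₁, p₂)| ≤ c₀e^{−δ′·pdist p₁ p₂}` whenever `pdist p₁ p₂ ≥ R₀`. [cite: BalabanImbrieJaffe1988, (2.16) p.261] -/
theorem decay216_native_of_ineq722 (hd : 2 ≤ P.d) {lev : ℕ → ℕ} (hlev : ∀ i, lev i ≤ P.m + P.K)
    (hcov : ∀ j ≤ P.m + P.K, ∃ i, lev i = j) {a : ℝ} (ha : 0 < a) {BondU : ℕ → Type}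
    {distEB : (i : ℕ) → TSite P 0 → BondU i → ℝ} {Cker : (i : ℕ) → Fin P.d → Fin P.d → TSite P (lev i) → TSite P (lev i) → ℝ}
    {Dker : (i : ℕ) → TSite P 0 → BondU i → ℝ}
    (h722 : KernelData.Ineq722
      (fun i => torusKernelData P (lev i) (deltaAData (hlev i) a) (BondU i) (distEB i) (Cker i) (Dker i)))
    {δC MC : ℝ} (hδC : 0 < δC) (hMC : 0 ≤ MC)
    (hC : ∀ j ≤ P.m + P.K, ∀ b b' : PBond P j, |⟪toEj P j (Pi.single b 1),
      CE P ((P.eta j) ^ P.d) ((P.L : ℝ) ^ j) j (toEj P j (Pi.single b' 1))⟫| ≤ MC * Real.exp (-(δC * (supDist b.src b'.src : ℝ)))) :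
    ∃ R₀ c₀ δ' : ℝ, 0 < δ' ∧ 0 ≤ c₀ ∧ ∀ (k : ℕ) (hk : k ≤ P.m + P.K) (p₁ p₂ : TPlaq P k), R₀ ≤ pdist p₁ p₂ →
        |sigmaTorus (P := P) hd ((P.eta k) ^ P.d) ((P.L : ℝ) ^ k) k (toU P k (Pi.single p₂ 1)) p₁| ≤
          c₀ * Real.exp (-δ' * pdist p₁ p₂) := by
  obtain ⟨δ, M, hδ, hM, hBall⟩ := exists_bound_of_ineq722 hlev h722
  have hd0 : (0 : ℝ) < P.d := by exact_mod_cast P.hd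
  have ha₀ : 0 < min δ δC / 2 := half_pos (lt_min hδ hδC)
  refine ⟨(P.d : ℝ) * (4 * δ / (min δ δC / 2) + 2),
    4 * M ^ 2 * MC * ((P.d : ℝ) ^ 2 * (Real.exp (min δ δC / 2 / 2) * ((2 * (1 + P.d / (min δ δC / 2))) ^ P.d) ^ 2)) *
      (((P.d + 1).factorial : ℝ) / (min δ δC / 2) ^ (P.d + 1)),
    min δ δC / 2 / 2 / P.d, by positivity, by positivity, fun k hk p₁ p₂ hfar => ?_⟩
  refine decay216_native_eta hd hk ha hδ hδC hMC (fun j hj hjk μ ν x y => ?_) (fun j hjk => hC j (by omega)) p₁ p₂ hfar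
  obtain ⟨i, hi⟩ := hcov j hj
  subst hi
  have h := hBall i μ ν x y
  rw [torusKernelData_gradH] at h
  exact (le_add_of_nonneg_left (abs_nonneg _)).trans h

/-- **the same with the C-input PHRASED AS THE TYPED ROW C1.Eq7.2.3** — r15's `KernelData.Ineq723 M_C δ_C` for p09's torus carrier at
scale `j` with its `C`-member := the matrix of the UNIT-LATTICE `C^{(j)} = CE P η_j^d L^j j` (p08's `cBound_of_ineq723` read at the native
weights), every `j ≤ m + K`. [cite: BalabanImbrieJaffe1988, (2.16) p.261] -/
theorem decay216_native_of_ineq723 (hd : 2 ≤ P.d) {lev : ℕ → ℕ} (hlev : ∀ i, lev i ≤ P.m + P.K)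
    (hcov : ∀ j ≤ P.m + P.K, ∃ i, lev i = j) {a : ℝ} (ha : 0 < a) {BondU : ℕ → Type}
    {distEB : (i : ℕ) → TSite P 0 → BondU i → ℝ} {Cker : (i : ℕ) → Fin P.d → Fin P.d → TSite P (lev i) → TSite P (lev i) → ℝ}
    {Dker : (i : ℕ) → TSite P 0 → BondU i → ℝ}
    (h722 : KernelData.Ineq722
      (fun i => torusKernelData P (lev i) (deltaAData (hlev i) a) (BondU i) (distEB i) (Cker i) (Dker i)))
    {δC MC : ℝ} (hδC : 0 < δC) (hMC : 0 ≤ MC)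
    {BondU' : ℕ → Type} {distEB' : (j : ℕ) → TSite P 0 → BondU' j → ℝ} {Dker' : (j : ℕ) → TSite P 0 → BondU' j → ℝ}
    (h723 : ∀ (j : ℕ) (hj : j ≤ P.m + P.K), (torusKernelData P j (deltaAData hj a) (BondU' j) (distEB' j)
      (fun μ ν y y' => ⟪toEj P j (Pi.single (⟨y, μ⟩ : PBond P j) 1),
        CE P ((P.eta j) ^ P.d) ((P.L : ℝ) ^ j) j (toEj P j (Pi.single (⟨y', ν⟩ : PBond P j) 1))⟫) (Dker' j)).Ineq723 MC δC) :
    ∃ R₀ c₀ δ' : ℝ, 0 < δ' ∧ 0 ≤ c₀ ∧ ∀ (k : ℕ) (hk : k ≤ P.m + P.K) (p₁ p₂ : TPlaq P k), R₀ ≤ pdist p₁ p₂ →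
        |sigmaTorus (P := P) hd ((P.eta k) ^ P.d) ((P.L : ℝ) ^ k) k (toU P k (Pi.single p₂ 1)) p₁| ≤
          c₀ * Real.exp (-δ' * pdist p₁ p₂) :=
  decay216_native_of_ineq722 hd hlev hcov ha h722 hδC hMC
    fun j hj => cBound_of_ineq723 (deltaAData hj a) (BondU' j) (distEB' j) (Dker' j) (h723 j hj)

/-- **(2.16) ON THE TORI GIVEN [6I] PROPOSITION 1.2 BY ITS TREE NAME AND THE NATIVE (7.2.3)**: the (7.2.2) input supplied by
`B5.Prop12Printed` for the torus carriers at all scales of the standing range (`levStd`; `BIJ85Ineq722DeltaA.ineq722_deltaA_of_prop12Printed`),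
the C-input = (7.2.3) for the unit-lattice matrices at every scale `j ≤ m + K`. [cite: BalabanImbrieJaffe1988, (2.16) p.261] -/
theorem decay216_native_of_prop12 (hd : 2 ≤ P.d) {a : ℝ} (ha : 0 < a)
    (h12 : B5.Prop12Printed (fun i => settingOf (torusRep P (levStd P i) (deltaAData (levStd_le i) a)) i))
    {δC MC : ℝ} (hδC : 0 < δC) (hMC : 0 ≤ MC)
    (hC : ∀ j ≤ P.m + P.K, ∀ b b' : PBond P j, |⟪toEj P j (Pi.single b 1),
      CE P ((P.eta j) ^ P.d) ((P.L : ℝ) ^ j) j (toEj P j (Pi.single b' 1))⟫| ≤ MC * Real.exp (-(δC * (supDist b.src b'.src : ℝ)))) :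
    ∃ R₀ c₀ δ' : ℝ, 0 < δ' ∧ 0 ≤ c₀ ∧ ∀ (k : ℕ) (hk : k ≤ P.m + P.K) (p₁ p₂ : TPlaq P k), R₀ ≤ pdist p₁ p₂ →
        |sigmaTorus (P := P) hd ((P.eta k) ^ P.d) ((P.L : ℝ) ^ k) k (toU P k (Pi.single p₂ 1)) p₁| ≤
          c₀ * Real.exp (-δ' * pdist p₁ p₂) :=
  decay216_native_of_ineq722 hd levStd_le (fun j hj => ⟨j, min_eq_left hj⟩) ha
    (ineq722_deltaA_of_prop12Printed (levStd P) levStd_le ha (fun _ => PUnit) (fun _ _ _ => 0) (fun _ _ _ _ _ => 0)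
      (fun _ _ _ => 0) h12) hδC hMC hC

/-! ## §3  (2.17) on the tori with (2.16) discharged from the NATIVE (7.2.3) -/

/-- **(2.17) ON THE TORI WITH ITS (2.16) INPUT DISCHARGED FROM THE NATIVE (7.2.3) — given only [6I] Proposition 1.2 by its tree name and
(7.2.3) for the unit-lattice `C^{(j)}`, every `j ≤ m + K`**: there are `R₀` and `C ≥ 0` such that at every scale `k ≤ m + K`, for every
radius `R ≥ R₀` with `2R < |T^{(k)}|` per direction, every `p₁` (`p₁.src = castSite z₁`) and every `f` that is a curl `∂A` on the box of
radius `R` about `p₁`: `|(σ_kf)(p₁)| ≤ C(1 + R)·‖f‖_∞` for p30's `σ_k = sigmaTorus hd η^d η⁻¹ k` — p08's `abs_ineq217_ineq722_torus` (the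
p. 262 argument, near part from (7.2.1)–(7.2.2)) fed with §2's `decay216_native_of_ineq722` and p08's plaquette row sums.
[cite: BalabanImbrieJaffe1988, (2.17) p.262] -/
theorem ineq217_native_of_prop12 (hd : 2 ≤ P.d) {a : ℝ} (ha : 0 < a)
    (h12 : B5.Prop12Printed (fun i => settingOf (torusRep P (levStd P i) (deltaAData (levStd_le i) a)) i))
    {δC MC : ℝ} (hδC : 0 < δC) (hMC : 0 ≤ MC)
    (hC : ∀ j ≤ P.m + P.K, ∀ b b' : PBond P j, |⟪toEj P j (Pi.single b 1),
      CE P ((P.eta j) ^ P.d) ((P.L : ℝ) ^ j) j (toEj P j (Pi.single b' 1))⟫| ≤ MC * Real.exp (-(δC * (supDist b.src b'.src : ℝ)))) :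
    ∃ R₀ C : ℝ, 0 ≤ C ∧ ∀ (k : ℕ) (hk : k ≤ P.m + P.K) (R : ℕ), R₀ ≤ R → 2 * R < P.sitesPerDir k →
      ∀ (p₁ : TPlaq P k) (z₁ : Fin P.d → ℤ), p₁.src = castSite z₁ →
      ∀ (f : TPlaq P k → ℝ) (A : VecField P k ℝ), (∀ p ∈ boxPlaqs (loOf z₁ R) (hiOf z₁ R), f p = curl 1 A p) →
        |sigmaTorus (P := P) hd ((P.eta k) ^ P.d) ((P.L : ℝ) ^ k) k (toU P k f) p₁| ≤ C * (1 + R) * supNorm f := by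
  have h722 := ineq722_deltaA_of_prop12Printed (levStd P) levStd_le ha (fun _ => PUnit) (fun _ _ _ => 0)
    (fun _ _ _ _ _ => 0) (fun _ _ _ => 0) h12
  have hcov : ∀ j ≤ P.m + P.K, ∃ i, levStd P i = j := fun j hj => ⟨j, min_eq_left hj⟩
  obtain ⟨C₁, hC₁, h217⟩ := abs_ineq217_ineq722_torus hd levStd_le ha h722
  obtain ⟨R₀, c₀, δ', hδ', hc₀, h216⟩ := decay216_native_of_ineq722 hd levStd_le hcov ha h722 hδC hMC hC
  set S : ℝ := (P.d : ℝ) ^ 2 * (2 * (1 + δ'⁻¹)) ^ P.d with hS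
  have hS0 : 0 ≤ S := by positivity
  have hd1 : (0 : ℝ) ≤ ((P.d - 1 : ℕ) : ℝ) := Nat.cast_nonneg _
  refine ⟨R₀, 2 * C₁ * ((P.d - 1 : ℕ) : ℝ) + c₀ * S * (1 + 8 * ((P.d - 1 : ℕ) : ℝ)), by positivity, ?_⟩
  intro k hk R hR0 hR p₁ z₁ h₁ f A hf
  obtain ⟨i, hi⟩ := hcov k hk
  subst hi
  have main := h217 i c₀ δ' S hc₀ R hR p₁ z₁ h₁ (fun p₂ hp => h216 (levStd P i) hk p₁ p₂ (hR0.trans hp))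
    (sum_plaq_exp_neg_pdist_le hδ' p₁) f A hf
  refine main.trans (mul_le_mul_of_nonneg_right ?_ (supNorm_nonneg f))
  have hR' : (0 : ℝ) ≤ R := Nat.cast_nonneg _
  push_cast
  nlinarith [mul_nonneg hC₁ hd1, mul_nonneg (mul_nonneg hc₀ hS0) hd1, mul_nonneg hC₁ (mul_nonneg hd1 hR'),
    mul_nonneg (mul_nonneg hc₀ hS0) hR']

/-! ## §4  (2.18)–(2.19) on the tori with (2.16) discharged from the NATIVE (7.2.3)  (v1.1, append-only) -/

/-- `c₀Se^{−(δ′/2)R} ≤ γ` for `R ≥ max(1, 2c₀S/(δ′γ))` (`e^{−y} ≤ 1/y`; p08's private lemma, re-proved). [folklore] -/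
private theorem small_of_large' {c₀ S δ' γ R : ℝ} (hc₀ : 0 ≤ c₀) (hS : 0 ≤ S) (hδ' : 0 < δ') (hγ : 0 < γ) (hR1 : 1 ≤ R)
    (hR : 2 * (c₀ * S) / (δ' * γ) ≤ R) : c₀ * Real.exp (-(δ' / 2) * R) * S ≤ γ := by
  have hy : 0 < δ' / 2 * R := by positivity
  have hexp : Real.exp (-(δ' / 2) * R) ≤ 1 / (δ' / 2 * R) := by
    rw [neg_mul, Real.exp_neg, one_div]
    exact inv_anti₀ hy ((by linarith : δ' / 2 * R ≤ δ' / 2 * R + 1).trans (Real.add_one_le_exp _))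
  have h1 : c₀ * Real.exp (-(δ' / 2) * R) * S ≤ c₀ * (1 / (δ' / 2 * R)) * S :=
    mul_le_mul_of_nonneg_right (mul_le_mul_of_nonneg_left hexp hc₀) hS
  refine h1.trans ?_
  rw [div_le_iff₀ (by positivity)] at hR
  rw [mul_one_div, div_mul_eq_mul_div, div_le_iff₀ hy]
  nlinarith

/-- **(2.18) ON THE TORI WITH (2.16) DISCHARGED FROM THE NATIVE (7.2.3)**: from `B5.Prop12Printed` (scales `levStd`) and (7.2.3) for the
UNIT-LATTICE matrices `⟨e_b, CE P η_j^d L^j j e_{b′}⟩`, every `j ≤ m + K`: `∃ R₀, c₀ ≥ 0, δ′ > 0` such that for EVERY `k ≤ m + K` and every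
`R ≥ R₀`, `Close pdist σ_{k,loc} σ_k (c₀e^{−(δ′/2)R}) (δ′/2)` for the kernel of `sigmaTorus hd η^d η⁻¹ k` and its (2.14)-truncation at radius
`R` (§2's `decay216_native_of_prop12` into p08's `close_trunc_of_decay3`). [cite: BalabanImbrieJaffe1988, (2.18) p.262] -/
theorem close218_native_of_prop12 (hd : 2 ≤ P.d) {a : ℝ} (ha : 0 < a)
    (h12 : B5.Prop12Printed (fun i => settingOf (torusRep P (levStd P i) (deltaAData (levStd_le i) a)) i))
    {δC MC : ℝ} (hδC : 0 < δC) (hMC : 0 ≤ MC)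
    (hC : ∀ j ≤ P.m + P.K, ∀ b b' : PBond P j, |⟪toEj P j (Pi.single b 1),
      CE P ((P.eta j) ^ P.d) ((P.L : ℝ) ^ j) j (toEj P j (Pi.single b' 1))⟫| ≤ MC * Real.exp (-(δC * (supDist b.src b'.src : ℝ)))) :
    ∃ R₀ c₀ δ' : ℝ, 0 < δ' ∧ 0 ≤ c₀ ∧ ∀ (k : ℕ) (hk : k ≤ P.m + P.K) (R : ℝ), R₀ ≤ R →
        Close pdist (trunc pdist R fun p q => sigmaTorus (P := P) hd ((P.eta k) ^ P.d) ((P.L : ℝ) ^ k) k (toU P k (Pi.single q 1)) p)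
          (fun p q => sigmaTorus (P := P) hd ((P.eta k) ^ P.d) ((P.L : ℝ) ^ k) k (toU P k (Pi.single q 1)) p)
          (c₀ * Real.exp (-(δ' / 2) * R)) (δ' / 2) := by
  obtain ⟨R₀, c₀, δ', hδ', hc₀, h216⟩ := decay216_native_of_prop12 hd ha h12 hδC hMC hC
  exact ⟨R₀, c₀, δ', hδ', hc₀, fun k hk R hR => close_trunc_of_decay3 hc₀ hδ'.le hR (h216 k hk)⟩

/-- **(2.19) ON THE TORI WITH (2.16) DISCHARGED FROM THE NATIVE (7.2.3) — «σ_{k,loc} ≧ c > 0» FOR `r(e_k)` LARGE, ONE RADIUS FOR ALL SCALES,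
every `d ≥ 2`**: from `B5.Prop12Printed` and (7.2.3) for the unit-lattice matrices at every scale: `∃ R₁` such that for EVERY `k ≤ m + K`
and every truncation radius `R ≥ R₁`, r18's `Ineq219 σ_{k,loc} (c711(d))` holds for the (2.14)-truncation of the kernel of `sigmaTorus hd η^d
η⁻¹ k` — [I] Thm. 7.1.1 at the physical weight (p08's `ineq219_sigmaKernel_eta`, constant `2c711(d)`), the closeness `close218_native_of_prop12`,
p02's `ineq219_of_close` with the plaquette row sums, and `c₀e^{−(δ′/2)R}·d²(2(1 + (δ′/2)⁻¹))^d ≤ c711(d)` for `R ≥ R₁`.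
[cite: BalabanImbrieJaffe1988, (2.19) p.262] -/
theorem ineq219_native_of_prop12 (hd : 2 ≤ P.d) {a : ℝ} (ha : 0 < a)
    (h12 : B5.Prop12Printed (fun i => settingOf (torusRep P (levStd P i) (deltaAData (levStd_le i) a)) i))
    {δC MC : ℝ} (hδC : 0 < δC) (hMC : 0 ≤ MC)
    (hC : ∀ j ≤ P.m + P.K, ∀ b b' : PBond P j, |⟪toEj P j (Pi.single b 1),
      CE P ((P.eta j) ^ P.d) ((P.L : ℝ) ^ j) j (toEj P j (Pi.single b' 1))⟫| ≤ MC * Real.exp (-(δC * (supDist b.src b'.src : ℝ)))) :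
    ∃ R₁ : ℝ, ∀ (k : ℕ) (hk : k ≤ P.m + P.K) (R : ℝ), R₁ ≤ R →
        Ineq219 (trunc pdist R fun p q => sigmaTorus (P := P) hd ((P.eta k) ^ P.d) ((P.L : ℝ) ^ k) k (toU P k (Pi.single q 1)) p)
          (c711 P.d) := by
  obtain ⟨R₀, c₀, δ', hδ', hc₀, h218⟩ := close218_native_of_prop12 hd ha h12 hδC hMC hC
  have hd0 : 0 < P.d := by have := P.hd; omega
  have hγ : 0 < c711 P.d := c711_pos hd0
  set S : ℝ := (P.d : ℝ) ^ 2 * (2 * (1 + (δ' / 2)⁻¹)) ^ P.d with hS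
  have hS0 : 0 ≤ S := by positivity
  refine ⟨max R₀ (max 1 (2 * (c₀ * S) / (δ' * c711 P.d))), fun k hk R hR => ?_⟩
  have hR0 : R₀ ≤ R := (le_max_left _ _).trans hR
  have hR1 : 1 ≤ R := ((le_max_left _ _).trans (le_max_right _ _)).trans hR
  have hR2 : 2 * (c₀ * S) / (δ' * c711 P.d) ≤ R := ((le_max_right _ _).trans (le_max_right _ _)).trans hR
  have hsmall' : c₀ * Real.exp (-(δ' / 2) * R) * S ≤ c711 P.d := small_of_large' hc₀ hS0 hδ' hγ hR1 hR2
  have hL : ((P.L : ℝ) ^ k) ≠ 0 := pow_ne_zero _ P.cast_L_pos.ne'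
  have h := ineq219_of_close (ineq219_sigmaKernel_eta hd hk hL) (h218 k hk R hR0) pdist_comm
    (fun p₁ => sum_plaq_exp_neg_pdist_le (half_pos hδ') p₁) (by positivity) (by linarith)
  exact ineq219_mono h hγ (by linarith)

end

end Literature.MathematicalPhysics.QuantumFieldTheory.BalabanImbrieJaffe1984to88.BIJ88Decay216Native
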